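import Mathlib
import Summits.ValiantsHypothesis.ValiantsHypothesis.Theorems.BarrierLeverFormulaSliceWitness
import Literature.Computability.AlgebraicComplexity.ArithCircuitProofs

/-!
# Route BarrierLever — crux `DefinableEquations` (stmt-8745) / item `SingleSizeEquations`
# (stmt-8749): a METHOD WALL — KALORKOTI'S FORMULA MEASURE IS SATURATED AT CIRCUIT SIZE `n²`,
# i.e. exactly at the crux's first open rung `b = 2` (val-np-p5 g10)

g3's formula slice (`…FormulaSliceEquations.lean`): the level-12 distinguisher `formulaCert n` —
the product over the `⌈n/2⌉` block variables `y = x_{⌊n/2⌋+k}` of the `⌊n/2⌋ × ⌊n/2⌋`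
determinants of coefficient variables `c_{y^{j+1} x_l}` (Kalorkoti's transcendence-degree measure
read at the origin) — vanishes at `coeff(f)` for every `f` of fan-in-two FORMULA size `≤ n²/20`,
and is nonzero at Kalorkoti's explicit polynomial `hardPoly n = Σ_k Σ_j x_{⌊n/2⌋+k}^{j+1} x_j`
(`eval_coeffVector_hardPoly_formulaCert`, value `1`).

**The wall (`hardPoly_mem_smallCircuits`, `not_isNaturalProof_formulaCert_smallCircuits_two`).**
`hardPoly n` has fan-in-two CIRCUIT complexity `≤ ⌈n/2⌉ · (2⌊n/2⌋ + 1) ≤ n²` (Horner in each block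
variable: `Σ_{j<m} y^{j+1} x_{w_j} = y · (x_{w_0} + Σ_{j<m-1} y^{j+1} x_{w_{j+1}})`, `2m` gates per
block, `complexity_block_le`) and degree `≤ n`, so it is a member of `SmallCircuits ℂ n 2` at which
`formulaCert n = 1`: the Kalorkoti certificate — and the method: EVERY block matrix of `hardPoly`
is nonsingular (`forall_det_block_ne_zero_hardPoly`), so no condition "some block matrix is
singular / has rank `< ⌊n/2⌋`" holds on `SmallCircuits ℂ n 2` (`not_forall_exists_det_block_eq_zero`) —
is dead against general circuits of size `n²`, PRECISELY the crux's first open rung `b = 2`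
(Chatterjee–Tengse §1.3 dir. 2), for every `n ≥ 2`, in any distinguisher class.

Chart line (method-wall axis, with `…PartialDerivativeWall`, `…FullRankMethodWall`,
`…ProductDepthWall`): Kalorkoti — natural proofs against FORMULAS `≤ n²/20` (g3); WALL at CIRCUIT
size `n²` (this file; the classical remark that the method "caps at `Σ_y rank ≤ n²`").  What this
is NOT: nothing on formulas of size between `n²/20` and `n²`, on the crux, or on `VP ≠ VNP`.
No definitions, no named facts, standard axioms.  Refs: Kalorkoti, SIAM J. Comput. 14 (1985)
Thm. 1; Forbes–Shpilka–Volk 2018 Def. 1/3.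
-/

-- `Summit.ValiantsHypothesis.ValiantsHypothesis.…` repeats a component by the D-0017 layout
-- (single-conjunct summit), which the `dupNamespace` linter flags; the name is mandated.
set_option linter.dupNamespace false

noncomputable section

namespace Summit.ValiantsHypothesis.ValiantsHypothesis.Theorems.BarrierLeverDefinableEquations

open MvPolynomial
open Literature.Computability.AlgebraicComplexity Literature.Barriers.ValiantsHypothesis
open Summit.ValiantsHypothesis.ValiantsHypothesis.Theorems.BarrierLever.FormulaSlice
open scoped BigOperators

namespace FormulaMethodWall

/-! ## §1 Horner: one block costs `2m` gates -/

/-- **Horner in the block variable**: `L(Σ_{j<m} y^{j+1} x_{w_j}) ≤ 2m` for any variable `y` and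
any column variables `w_j` (`y · (x_{w_0} + (…))`). [cite: Burgisser2000, §2.1] -/
theorem complexity_block_le {n : ℕ} (y : Fin n) :
    ∀ (m : ℕ) (w : Fin m → Fin n),
      complexity (∑ j : Fin m, (X y : MvPolynomial (Fin n) ℂ) ^ ((j : ℕ) + 1) * X (w j)) ≤ 2 * m
  | 0, w => by
    rw [Fin.sum_univ_zero]
    simpa using (complexity_C_holds (σ := Fin n) (0 : ℂ)).le
  | m + 1, w => by
    have hrec := complexity_block_le y m (fun j => w j.succ)
    -- `Σ_{j<m+1} y^{j+1} x_{w j} = y * (x_{w 0} + Σ_{j<m} y^{j+1} x_{w (j+1)})`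
    have hid : (∑ j : Fin (m + 1), (X y : MvPolynomial (Fin n) ℂ) ^ ((j : ℕ) + 1) * X (w j)) =
        X y * (X (w 0) + ∑ j : Fin m, (X y : MvPolynomial (Fin n) ℂ) ^ ((j : ℕ) + 1) * X (w j.succ)) := by
      rw [Fin.sum_univ_succ, mul_add, Finset.mul_sum]
      congr 1
      · simp
      · refine Finset.sum_congr rfl fun j _ => ?_
        rw [Fin.val_succ, ← mul_assoc, ← pow_succ']
    rw [hid]
    calc complexity (X y * (X (w 0) + ∑ j : Fin m, (X y : MvPolynomial (Fin n) ℂ) ^ ((j : ℕ) + 1) *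
            X (w j.succ)))
        ≤ complexity (X y : MvPolynomial (Fin n) ℂ) +
            complexity (X (w 0) + ∑ j : Fin m, (X y : MvPolynomial (Fin n) ℂ) ^ ((j : ℕ) + 1) *
              X (w j.succ)) + 1 := complexity_mul_le_holds _ _
      _ ≤ 0 + (0 + 2 * m + 1) + 1 := by
          gcongr
          · exact (complexity_X_holds (k := ℂ) y).le
          · refine (complexity_add_le_holds _ _).trans ?_
            gcongr
            · exact (complexity_X_holds (k := ℂ) (w 0)).le
      _ = 2 * (m + 1) := by ring

/-! ## §2 Kalorkoti's polynomial is a small circuit -/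

/-- `L(hardPoly n) ≤ ⌈n/2⌉ · 2⌊n/2⌋ + ⌈n/2⌉`: Horner in each of the `⌈n/2⌉` block variables, then the
sum of the blocks. [cite: Kalorkoti1985, Thm. 1] [cite: Burgisser2000, §2.1] -/
theorem complexity_hardPoly_le (n : ℕ) :
    complexity (hardPoly n) ≤ (n - n / 2) * (2 * (n / 2)) + (n - n / 2) := by
  classical
  rw [hardPoly_eq_sum]
  refine (complexity_finset_sum_le _ _).trans ?_
  rw [Finset.card_univ, Fintype.card_fin]
  refine Nat.add_le_add_right ?_ _
  calc ∑ k : Fin (n - n / 2), complexity (∑ j : Fin (n / 2),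
          (X (blockVar n k) : MvPolynomial (Fin n) ℂ) ^ ((j : ℕ) + 1) * X (colVar n j))
      ≤ ∑ _k : Fin (n - n / 2), 2 * (n / 2) :=
        Finset.sum_le_sum fun k _ => complexity_block_le (blockVar n k) (n / 2) (colVar n)
    _ = (n - n / 2) * (2 * (n / 2)) := by
        rw [Finset.sum_const, Finset.card_univ, Fintype.card_fin, smul_eq_mul]

/-- **`hardPoly n ∈ SmallCircuits ℂ n 2`** for every `n`: degree `≤ n` (g3) and complexity
`≤ ⌈n/2⌉ (2⌊n/2⌋ + 1) ≤ n²`. [cite: ForbesShpilkaVolk2018, Cor. 5] -/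
theorem hardPoly_mem_smallCircuits (n : ℕ) : hardPoly n ∈ SmallCircuits ℂ n 2 := by
  refine ⟨totalDegree_hardPoly_le n, (complexity_hardPoly_le n).trans ?_⟩
  have h1 : (n - n / 2) * (2 * (n / 2)) + (n - n / 2) = (n - n / 2) * (2 * (n / 2) + 1) := by ring
  rw [h1, sq]
  rcases Nat.even_or_odd n with ⟨m, hm⟩ | ⟨m, hm⟩
  · subst hm
    have h2 : (m + m) / 2 = m := by omega
    rw [h2]
    have h3 : m + m - m = m := by omega
    rw [h3]
    nlinarith
  · subst hm
    have h2 : (2 * m + 1) / 2 = m := by omega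
    rw [h2]
    have h3 : 2 * m + 1 - m = m + 1 := by omega
    rw [h3]
    nlinarith

/-- Also a member of `SmallCircuits ℂ n b` for every `b ≥ 2` (`n ≥ 1`). [cite: ForbesShpilkaVolk2018, Cor. 5] -/
theorem hardPoly_mem_smallCircuits_of_le {n b : ℕ} (hn : 1 ≤ n) (hb : 2 ≤ b) :
    hardPoly n ∈ SmallCircuits ℂ n b :=
  smallCircuits_mono ℂ hb hn (hardPoly_mem_smallCircuits n)

/-! ## §3 The wall -/

/-- **The formula certificate does not vanish on `SmallCircuits ℂ n 2`**: it takes the value `1`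
at the size-`≤ n²` circuit `hardPoly n`. [cite: Kalorkoti1985, Thm. 1] -/
theorem exists_smallCircuits_two_eval_formulaCert_ne_zero (n : ℕ) :
    ∃ f ∈ SmallCircuits ℂ n 2, eval (coeffVector (degLEMonomials n) f) (formulaCert n) ≠ 0 :=
  ⟨hardPoly n, hardPoly_mem_smallCircuits n, by
    rw [eval_coeffVector_hardPoly_formulaCert]; exact one_ne_zero⟩

/-- **The wall in FSV's vocabulary**: for NO distinguisher class `𝒟` is g3's Kalorkoti certificate
`formulaCert n` an `IsNaturalProof` against `SmallCircuits ℂ n 2` — the crux's first open rung.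
[cite: ForbesShpilkaVolk2018, Def. 1] -/
theorem not_isNaturalProof_formulaCert_smallCircuits_two (n : ℕ)
    (𝒟 : Set (MvPolynomial (degLEMonomials n) ℂ)) :
    ¬ IsNaturalProof (degLEMonomials n) (SmallCircuits ℂ n 2) 𝒟 (formulaCert n) := by
  rintro ⟨-, -, hvan⟩
  obtain ⟨f, hf, hne⟩ := exists_smallCircuits_two_eval_formulaCert_ne_zero n
  exact hne (hvan f hf)

/-- The same for every `b ≥ 2` (`n ≥ 1`). [cite: ForbesShpilkaVolk2018, Def. 1] -/
theorem not_isNaturalProof_formulaCert_smallCircuits {n b : ℕ} (hn : 1 ≤ n) (hb : 2 ≤ b)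
    (𝒟 : Set (MvPolynomial (degLEMonomials n) ℂ)) :
    ¬ IsNaturalProof (degLEMonomials n) (SmallCircuits ℂ n b) 𝒟 (formulaCert n) := by
  rintro ⟨-, -, hvan⟩
  have h := hvan _ (hardPoly_mem_smallCircuits_of_le hn hb)
  rw [eval_coeffVector_hardPoly_formulaCert] at h
  exact one_ne_zero h

/-- **The METHOD, not just the certificate**: EVERY Kalorkoti block matrix of `hardPoly n` is
nonsingular (their determinants multiply to `1`), so the rank condition of the method — "some
block variable `y` has coefficient matrix `(c_{y^{j+1} x_l})` of rank `< ⌊n/2⌋`", which every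
formula of size `≤ n²/20` satisfies — fails at a member of `SmallCircuits ℂ n 2`.
[cite: Kalorkoti1985, Thm. 1] -/
theorem forall_det_block_ne_zero_hardPoly (n : ℕ) (k : Fin (n - n / 2)) :
    (Matrix.of fun j l => coeffVector (degLEMonomials n) (hardPoly n) (certMonomial n k j l)).det ≠ 0 := by
  classical
  have h := eval_coeffVector_hardPoly_formulaCert (n := n)
  rw [eval_formulaCert] at h
  have hne : (∏ k : Fin (n - n / 2), (Matrix.of fun j l =>
      coeffVector (degLEMonomials n) (hardPoly n) (certMonomial n k j l)).det) ≠ 0 := by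
    rw [h]; exact one_ne_zero
  exact Finset.prod_ne_zero_iff.1 hne k (Finset.mem_univ k)

/-- Hence the Kalorkoti class condition "at `coeff(f)` some block determinant vanishes" does NOT
hold throughout `SmallCircuits ℂ n 2` (`n ≥ 2`, so that there is at least one block).
[cite: Kalorkoti1985, Thm. 1] -/
theorem not_forall_exists_det_block_eq_zero {n : ℕ} (hn : 2 ≤ n) :
    ¬ ∀ f ∈ SmallCircuits ℂ n 2, ∃ k : Fin (n - n / 2),
      (Matrix.of fun j l => coeffVector (degLEMonomials n) f (certMonomial n k j l)).det = 0 := by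
  intro h
  have _ : 0 < n - n / 2 := by omega
  obtain ⟨k, hk⟩ := h _ (hardPoly_mem_smallCircuits n)
  exact forall_det_block_ne_zero_hardPoly n k hk

end FormulaMethodWall

end Summit.ValiantsHypothesis.ValiantsHypothesis.Theorems.BarrierLeverDefinableEquations
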